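import Summits.ABC.ABC.Theses.PadicPrimesYuNinetyOddRadOne
import Summits.ABC.ABC.Theorems.PadicPrimesW80TwoThirdsW80ThreeModFour
import Summits.ABC.StewartYu.YuNinetyW80KappaTransfer
import HarnessLib

set_option linter.dupNamespace false

/-!
# Route PadicPrimesYuNinetyOddRadOne (rung A1.M2⁻), crux `FinBoundThreeModFour` (stmt-ABC-19455)

`Summits/ABC/ABC/Theorems/PadicPrimesYuNinetyOddRadOneFinBoundThreeModFour.lean` — cell
`abc-stewartyu`, seat p2 (g2).  The `Fin`-indexed `p`-adic bound at `p ≡ 3 (mod 4)` with exponents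
`(κ, σ, τ, τ₁) = (1, 2, 1, 2)`: the crux `W80ThreeModFour` just proved
(`padicPrimesW80TwoThirds_w80ThreeModFour_proof`, the twisted `p`-adic Waldschmidt descent) fed to
p3's landed κ-transfer `YuNinetyW80Kappa.finBoundAt_of_residueClass_aux` (`K = 8`,
`L = 2·max(1,|c₅|)`).  [folklore] assembly.
-/

namespace Summit.ABC.ABC.Theorems

/-- **Item stmt-ABC-19455 `FinBoundThreeModFour`**: for `p ≡ 3 (mod 4)`,
`ord_p(∏ qᵢ^{eᵢ} − 1) ≤ K·Lⁿ·nⁿ·p²·(∏ log qᵢ)·log B·(log ∏ qᵢ)²`. [folklore] -/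
theorem padicPrimesYuNinetyOddRadOne_finBoundThreeModFour_proof :
    Summit.ABC.ABC.Theses.PadicPrimesYuNinetyOddRadOne.FinBoundThreeModFour := by
  have h0 := padicPrimesW80TwoThirds_w80ThreeModFour_proof
  unfold Summit.ABC.ABC.Theses.PadicPrimesW80TwoThirds.W80ThreeModFour at h0
  obtain ⟨c₅, h⟩ := h0
  refine ⟨8, 2 * max 1 |c₅|, by norm_num, ?_, fun p hp hp4 => ?_⟩
  · have := le_max_left (1 : ℝ) |c₅|; linarith
  · exact Summit.ABC.StewartYu.YuNinetyW80Kappa.finBoundAt_of_residueClass_aux hp (h p hp hp4)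
      (le_max_left _ _) (le_max_right _ _)

end Summit.ABC.ABC.Theorems
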